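import Literature.Probability.LatticeModels.SahiThirdOrderCorrelation
import Summits.CriticalPhenomena.PercolationContinuityZ3.Theorems.PercNearOneGluingNoHeavyLowerTailSahiC3CubeThreeFKG
import Summits.CriticalPhenomena.PercolationContinuityZ3.Theorems.PercNearOneGluingNoHeavyLowerTailSahiC3CubeFourFKG
import Mathlib.Tactic.Linarith
import Mathlib.Tactic.Ring
import HarnessLib
import HarnessLib.Audit

/-!
# `NoHeavyLowerTail` (crux stmt-CriticalPhenomena-4575), Sahi programme P4: the level-`z₂` mixed block, `K₀`-null case —
# LEMMA L′ IS SAHI'S `E₃` PLUS HARRIS (the "three-set inequality T3" of gen 30 is `latticeE3` itself)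

Support file (cell `prim-l12`, seat P4, generation 31; `--supports stmt-CriticalPhenomena-4575`).  No named facts, no sorries;
standard axioms; def-free.

Context (HOME prim-l12-p4/FROM-prim-l12-p4-gen30-MIXED-BLOCK-STRUCTURE.md, ADDENDUM R8).  On the sub-universe `W4`
(`K₀ = O₀ = ∅`, `L₀ = P₀ = Q ⊆ S = L₁ = P₁ ⊇ K = K₁ = O₁`, primed columns constant `Y = K'`, `Z = L'`) the `R`-free member
`F_S` of the level-`z₂` mixed block reduces by an exact Harris chain (gen 30, `code/gen30/w4bound.py`) to
  LEMMA L′(Q,Y,Z,V):  `(2−v)·a(Q∩W) − v·c(Q∩W) + a(Q∩Z) − y·a(Q) − (1−v)·y·q + q·c(Y) ≥ 0`,  `W := Y ∪ Z`,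
where, for the block weight `w ≥ 0` of mass `1` and the slot `V`, `a(X) = w(X∩V)`, `c(X) = w(X∖V)`, `v = w(V)`, `y = w(Y)`,
`q = w(Q)`.  Gen 30 observed that the case `Z = ∅` is a "three-set correlation inequality T3(Q,Y,V)".  THIS FILE records that
`T3` is literally Sahi's third-order functional `latticeE3 w Q Y V` (`Literature…SahiThirdOrderCorrelation`; Sahi 2008 / Lieb–Sahi
`E₃`, Kahn's Conjecture 5 for product weights) and proves the exact identity
  `L′(Q,Y,Z,V) = latticeE3 w Q (Y∪Z) V + a(Q∩Z) + w(Z∖Y)·(a(Q) − q·v) + q·a(Z∖Y)`      (`lprime_eq`)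
(for `∑ w = 1`; checked beforehand in exact rationals on 4 500 random instances, `lab/t_Lprime.py`).  Hence L′ follows from
`0 ≤ latticeE3 w Q (Y∪Z) V` and Harris for the pair `(Q,V)` (`lprime_nonneg_of_latticeE3`); in particular it holds
UNCONDITIONALLY for every FKG weight on the flagship block `{0,1}³` and on `{0,1}⁴` (`lprime_nonneg_cube_three`,
`lprime_nonneg_cube_four`, by the tree theorems `…SahiC3Cube.latticeE3_nonneg_cube_three`, `…SahiC3CubeFourFKG.sahiC3_cube_four_fkg`),
and for a general block it is exactly an instance of Sahi's `C₃` on that block (so the "general-block" level-`z₂` lemma is an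
induction on `C₃`, not a new inequality). [this work]
-/

namespace Summit.CriticalPhenomena.PercolationContinuityZ3.Theorems.SahiE3LevelZ2LPrime

open Finset Literature.Probability.LatticeModels
open scoped BigOperators

variable {B : Type*} [Fintype B] [DecidableEq B]

omit [Fintype B] in
/-- `w(Y ∪ Z) = w(Z ∖ Y) + w(Y)`. [folklore] -/
theorem mass_union_eq_sdiff_add (w : B → ℝ) (Y Z : Finset B) :
    mass w (Y ∪ Z) = mass w (Z \ Y) + mass w Y := by
  unfold mass
  rw [← Finset.sum_union (Finset.sdiff_disjoint), Finset.sdiff_union_self_eq_union, Finset.union_comm]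

omit [Fintype B] in
/-- `w((Y ∪ Z) ∩ V) = w((Z ∖ Y) ∩ V) + w(Y ∩ V)`. [folklore] -/
theorem mass_union_inter_eq_sdiff_add (w : B → ℝ) (Y Z V : Finset B) :
    mass w ((Y ∪ Z) ∩ V) = mass w ((Z \ Y) ∩ V) + mass w (Y ∩ V) := by
  unfold mass
  rw [← Finset.sum_union]
  · congr 1
    ext b
    simp only [Finset.mem_inter, Finset.mem_union, Finset.mem_sdiff]
    tauto
  · exact Finset.disjoint_left.2 fun b hb hb' => by
      simp only [Finset.mem_inter, Finset.mem_sdiff] at hb hb'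
      exact hb.1.2 hb'.1

/-- **LEMMA L′ is `E₃` plus three nonnegative terms (exact identity).**  For a weight `w` of total mass `1` on a finite type and
finite sets `Q, Y, Z, V` (slot `V`, `v = w(V)`, `a(X) = w(X ∩ V)`, `c(X) = w(X) − w(X ∩ V)`):
`(2−v)·a(Q∩(Y∪Z)) − v·c(Q∩(Y∪Z)) + a(Q∩Z) − w(Y)·a(Q) − (1−v)·w(Y)·w(Q) + w(Q)·c(Y)`
`= latticeE3 w Q (Y∪Z) V + a(Q∩Z) + w(Z∖Y)·(a(Q) − w(Q)·v) + w(Q)·a(Z∖Y)`. [this work] -/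
theorem lprime_eq (w : B → ℝ) (hw1 : ∑ b, w b = 1) (Q Y Z V : Finset B) :
    (2 - mass w V) * mass w (Q ∩ (Y ∪ Z) ∩ V) - mass w V * (mass w (Q ∩ (Y ∪ Z)) - mass w (Q ∩ (Y ∪ Z) ∩ V))
        + mass w (Q ∩ Z ∩ V) - mass w Y * mass w (Q ∩ V) - (1 - mass w V) * mass w Y * mass w Q
        + mass w Q * (mass w Y - mass w (Y ∩ V))
      = latticeE3 w Q (Y ∪ Z) V + mass w (Q ∩ Z ∩ V) + mass w (Z \ Y) * (mass w (Q ∩ V) - mass w Q * mass w V)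
        + mass w Q * mass w ((Z \ Y) ∩ V) := by
  have hu : mass w univ = 1 := by rw [mass_univ]; exact hw1
  have h1 := mass_union_eq_sdiff_add w Y Z
  have h2 := mass_union_inter_eq_sdiff_add w Y Z V
  unfold latticeE3
  rw [hu]
  linear_combination (mass w Q) * h2 - (mass w V * mass w Q - mass w (Q ∩ V)) * h1

/-- **L′ from Sahi's `C₃` for the triple `(Q, Y∪Z, V)` and Harris for `(Q,V)`.**  If `w ≥ 0` has mass `1`,
`w(Q)·w(V) ≤ w(Q∩V)` and `0 ≤ latticeE3 w Q (Y∪Z) V`, then LEMMA L′(Q,Y,Z,V) holds. [this work] -/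
theorem lprime_nonneg_of_latticeE3 (w : B → ℝ) (hw : ∀ b, 0 ≤ w b) (hw1 : ∑ b, w b = 1) (Q Y Z V : Finset B)
    (hHarris : mass w Q * mass w V ≤ mass w (Q ∩ V)) (hC3 : 0 ≤ latticeE3 w Q (Y ∪ Z) V) :
    0 ≤ (2 - mass w V) * mass w (Q ∩ (Y ∪ Z) ∩ V) - mass w V * (mass w (Q ∩ (Y ∪ Z)) - mass w (Q ∩ (Y ∪ Z) ∩ V))
        + mass w (Q ∩ Z ∩ V) - mass w Y * mass w (Q ∩ V) - (1 - mass w V) * mass w Y * mass w Q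
        + mass w Q * (mass w Y - mass w (Y ∩ V)) := by
  rw [lprime_eq w hw1]
  have hw0 : 0 ≤ w := fun b => hw b
  have t1 : 0 ≤ mass w (Q ∩ Z ∩ V) := mass_nonneg hw0 _
  have t2 : 0 ≤ mass w (Z \ Y) * (mass w (Q ∩ V) - mass w Q * mass w V) :=
    mul_nonneg (mass_nonneg hw0 _) (sub_nonneg.2 hHarris)
  have t3 : 0 ≤ mass w Q * mass w ((Z \ Y) ∩ V) := mul_nonneg (mass_nonneg hw0 _) (mass_nonneg hw0 _)
  linarith

/-- **L′ on a finite distributive lattice, conditional form.**  For an FKG probability weight (`w ≥ 0` log-supermodular, mass `1`)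
and up-sets `Q, V`, LEMMA L′(Q,Y,Z,V) follows from the single `C₃` instance `0 ≤ latticeE3 w Q (Y∪Z) V` (Harris for `(Q,V)` is
Mathlib's four-functions theorem via `Literature…fkg_upperSet_mass`). [this work] -/
theorem lprime_nonneg_of_fkg {L : Type*} [DistribLattice L] [Fintype L] [DecidableEq L] (w : L → ℝ) (hw : ∀ b, 0 ≤ w b)
    (hfkg : ∀ a b, w a * w b ≤ w (a ⊓ b) * w (a ⊔ b)) (hw1 : ∑ b, w b = 1) (Q Y Z V : Finset L)
    (hQ : IsUpperSet (Q : Set L)) (hV : IsUpperSet (V : Set L)) (hC3 : 0 ≤ latticeE3 w Q (Y ∪ Z) V) :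
    0 ≤ (2 - mass w V) * mass w (Q ∩ (Y ∪ Z) ∩ V) - mass w V * (mass w (Q ∩ (Y ∪ Z)) - mass w (Q ∩ (Y ∪ Z) ∩ V))
        + mass w (Q ∩ Z ∩ V) - mass w Y * mass w (Q ∩ V) - (1 - mass w V) * mass w Y * mass w Q
        + mass w Q * (mass w Y - mass w (Y ∩ V)) := by
  have hw0 : 0 ≤ w := fun b => hw b
  have hH := fkg_upperSet_mass hw0 hfkg hQ hV
  have hu : mass w univ = 1 := by rw [mass_univ]; exact hw1
  rw [hu, one_mul] at hH
  exact lprime_nonneg_of_latticeE3 w hw hw1 Q Y Z V hH hC3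

/-- **L′ holds unconditionally on the flagship block `{0,1}³`** (every FKG probability weight, `Q, Y, Z, V` up-sets), by
`…SahiC3Cube.latticeE3_nonneg_cube_three` (Sahi's `C₃` on `{0,1}³`). [this work] -/
theorem lprime_nonneg_cube_three (w : (Fin 3 → Bool) → ℝ) (hw : ∀ b, 0 ≤ w b)
    (hfkg : ∀ a b, w a * w b ≤ w (a ⊓ b) * w (a ⊔ b)) (hw1 : ∑ b, w b = 1) (Q Y Z V : Finset (Fin 3 → Bool))
    (hQ : IsUpperSet (Q : Set (Fin 3 → Bool))) (hY : IsUpperSet (Y : Set (Fin 3 → Bool)))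
    (hZ : IsUpperSet (Z : Set (Fin 3 → Bool))) (hV : IsUpperSet (V : Set (Fin 3 → Bool))) :
    0 ≤ (2 - mass w V) * mass w (Q ∩ (Y ∪ Z) ∩ V) - mass w V * (mass w (Q ∩ (Y ∪ Z)) - mass w (Q ∩ (Y ∪ Z) ∩ V))
        + mass w (Q ∩ Z ∩ V) - mass w Y * mass w (Q ∩ V) - (1 - mass w V) * mass w Y * mass w Q
        + mass w Q * (mass w Y - mass w (Y ∩ V)) := by
  have hYZ : IsUpperSet ((Y ∪ Z : Finset (Fin 3 → Bool)) : Set (Fin 3 → Bool)) := by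
    rw [Finset.coe_union]; exact hY.union hZ
  exact lprime_nonneg_of_fkg w hw hfkg hw1 Q Y Z V hQ hV
    (SahiC3Cube.latticeE3_nonneg_cube_three (fun b => hw b) hfkg hQ hYZ hV)

/-- **L′ holds unconditionally on the block `{0,1}⁴`** (every FKG probability weight, `Q, Y, Z, V` up-sets), by
`…SahiC3CubeFourFKG.sahiC3_cube_four_fkg` (Sahi's `C₃` on `{0,1}⁴`). [this work] -/
theorem lprime_nonneg_cube_four (w : (Fin 4 → Bool) → ℝ) (hw : ∀ b, 0 ≤ w b)
    (hfkg : ∀ a b, w a * w b ≤ w (a ⊓ b) * w (a ⊔ b)) (hw1 : ∑ b, w b = 1) (Q Y Z V : Finset (Fin 4 → Bool))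
    (hQ : IsUpperSet (Q : Set (Fin 4 → Bool))) (hY : IsUpperSet (Y : Set (Fin 4 → Bool)))
    (hZ : IsUpperSet (Z : Set (Fin 4 → Bool))) (hV : IsUpperSet (V : Set (Fin 4 → Bool))) :
    0 ≤ (2 - mass w V) * mass w (Q ∩ (Y ∪ Z) ∩ V) - mass w V * (mass w (Q ∩ (Y ∪ Z)) - mass w (Q ∩ (Y ∪ Z) ∩ V))
        + mass w (Q ∩ Z ∩ V) - mass w Y * mass w (Q ∩ V) - (1 - mass w V) * mass w Y * mass w Q
        + mass w Q * (mass w Y - mass w (Y ∩ V)) := by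
  have hYZ : IsUpperSet ((Y ∪ Z : Finset (Fin 4 → Bool)) : Set (Fin 4 → Bool)) := by
    rw [Finset.coe_union]; exact hY.union hZ
  exact lprime_nonneg_of_fkg w hw hfkg hw1 Q Y Z V hQ hV
    (SahiC3CubeFourFKG.sahiC3_cube_four_fkg (fun b => hw b) hfkg Q (Y ∪ Z) V hQ hYZ hV)

end Summit.CriticalPhenomena.PercolationContinuityZ3.Theorems.SahiE3LevelZ2LPrime
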